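import Summits.BirchSwinnertonDyer.BirchSwinnertonDyer.Theorems.EisensteinPrimesCrystalTransportsMu
import Summits.BirchSwinnertonDyer.BirchSwinnertonDyer.Theorems.EisensteinPrimesCrystalTransportsLambda
import Summits.BirchSwinnertonDyer.BirchSwinnertonDyer.Theorems.EisensteinPrimesCrystalLambdaSigma
import Summits.BirchSwinnertonDyer.BirchSwinnertonDyer.Theorems.EisensteinPrimesBSDpOnCellCImprimitiveCountWallOfInputs
import Summits.BirchSwinnertonDyer.BirchSwinnertonDyer.Theorems.EisensteinPrimesBSDpOnCellCBrOmegaMultOfPrint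
import Summits.BirchSwinnertonDyer.BirchSwinnertonDyer.Theorems.EisensteinPrimesBSDpOnCellCImprimitiveCountNonsplitOfPrint
import Summits.BirchSwinnertonDyer.BirchSwinnertonDyer.Theorems.EisensteinPrimesBSDpOnCellCImprimitiveCountSplitOfBrAnomHlatLightTC
import Summits.BirchSwinnertonDyer.BirchSwinnertonDyer.Theorems.EisensteinPrimesKellerYinLemma511OfBrAnom
import Summits.BirchSwinnertonDyer.BirchSwinnertonDyer.Theorems.EisensteinPrimesBSDpOnCellCMemberInvariantsOfAnacongWt
import Summits.BirchSwinnertonDyer.BirchSwinnertonDyer.Theorems.EisensteinPrimesBSDpOnCellCCrystallineFibreOfCas20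
import Summits.BirchSwinnertonDyer.BirchSwinnertonDyer.Theorems.SchneiderFreeAdditiveX3PoitouTateSelmerDualityHolds
import Summits.BirchSwinnertonDyer.BirchSwinnertonDyer.Theorems.SchneiderFreeAdditiveX3PoitouTateShaDualityHolds
import Literature.NumberTheory.IwasawaTheory.Greenberg2006.LocalH2VanishingOfLOC1
import Summits.BirchSwinnertonDyer.BirchSwinnertonDyer.Theorems.EisensteinPrimesBSDpOnCellCResidualV11
import Summits.BirchSwinnertonDyer.BirchSwinnertonDyer.Theorems.EisensteinPrimesKellerYinLemma511OfBr
import Summits.BirchSwinnertonDyer.BirchSwinnertonDyer.Theorems.EisensteinPrimesKellerYinBROmegaLightBridges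
import Summits.BirchSwinnertonDyer.BirchSwinnertonDyer.Theorems.EisensteinPrimesBSDpOnCellCImprimitiveCountSplitTransport
import Summits.BirchSwinnertonDyer.BirchSwinnertonDyer.Theorems.EisensteinPrimesBSDpOnCellCImprimitiveCountSplitOfBrHlatLightTC
import Summits.BirchSwinnertonDyer.BirchSwinnertonDyer.Theorems.EisensteinPrimesBSDpOnCellCAccumDefs
import Summits.BirchSwinnertonDyer.BirchSwinnertonDyer.Theorems.EisensteinPrimesResidualCharacterSelmerFiniteOfFact
import Summits.BirchSwinnertonDyer.Rank1Residual.X2.CpIntSeriesCongruenceLimit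
import Literature.NumberTheory.EllipticCurves.Skinner2016.HidaCongruentMembers
import Literature.NumberTheory.EllipticCurves.BDPAnticyclotomicPAdicLFunctionSigmaInt
import Literature.NumberTheory.EllipticCurves.SigmaEulerData
import Summits.BirchSwinnertonDyer.BirchSwinnertonDyer.Theorems.ErratumRoadFiveSigmaEulerFactorFirstUnitCoeff
import Summits.BirchSwinnertonDyer.BirchSwinnertonDyer.Theorems.EisensteinPrimesNumPlacesAboveRepresentatives
import Summits.BirchSwinnertonDyer.BirchSwinnertonDyer.Theorems.UniversalToricDescentSigmaEulerMuZero
import Summits.BirchSwinnertonDyer.BirchSwinnertonDyer.Theorems.ErratumRoadFiveIMCDivRoadFFSigmaDataBNoDefect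
import Summits.BirchSwinnertonDyer.Rank1Residual.X11b.RouteR1IntReceptacle
import Literature.NumberTheory.EllipticCurves.KellerYin2024.AnticyclotomicLocalEulerFactors
import Literature.NumberTheory.EllipticCurves.HasseWeilAbelianBadReduction
import Literature.NumberTheory.EllipticCurves.HasseWeilGoodReductionFrobenius
import Literature.NumberTheory.GaloisCohomology.CyclotomicCharacterPPrimary
import Literature.NumberTheory.GaloisRepresentations.LocalFrobeniusDensity
import HarnessLib

/-!
# Crux 4 `BSDpOnCellC` (stmt-BirchSwinnertonDyer-19034), line «crystal» v10: THE COMPOSITION OF RECORD AS A TREE THEOREM — the crux BY NAME from the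
# SIX registered stub texts as hypotheses (the crux-3 `…OfNamedFactsV12` pattern; cell `bsd-eis`, LEAD cruxlead-19034 g0; `--supports -19034`)

v9 → v10: the registered stub `stub_crystallineFibre` (I) «the crystalline fibre congruence» is NO LONGER A HYPOTHESIS — it is supplied, token for token, by
x2-p2 g13's tree theorem `CrystallineFibreOfCas20.crystallineFibre_of_cas20` (p696082) from ONE named Literature statement
`Castella2018.cas20_thm211_memberForms_sigmaFrames_congr` (p695749; Castella JIMJ 19 (2020) Thm. 2.11 ∘ Castella CJM 6 (2018) (3.1)/(4.1) ∘ Skinner 2016 §2.6 — the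
FORM-level, IMAGE-free member/Σ-frame congruence at depth `m = 1`, weight class `r = 0`), which joins `hPub` as its LAST conjunct (27 PUBLISHED named facts); AND `hMember` = `stub_memberInvariants` is now BY NAME the conjunction of the two weight-`k`
analytic statements of Keller–Yin 2024 Thm. 2.2.2 (`anacong`) for the crystalline Hida member, `KellerYin2024.thm222_anacong_hidaMember_sigma_mu_OPEN ∧
KellerYin2024.thm222_anacong_hidaMember_sigma_lambda_OPEN` (x2-p2 g13, p692600, statement-only lane; [claim: KellerYin2024]-grade — NOT merged into `hPub`),
from which the v6–v9 EXPLICIT text (i) ∧ (ii′) is RECOVERED token for token by x2-p2 g13's tree theorem `MemberInvariantsOfAnacongWt.memberInvariants_of_anacongWt`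
(p693188) inside the proof (`hMemberI`). x2-p2 g13's glue p696082 replaces the earlier p695840 (procedural `dedup.landed` bounce, no mathematical change).

HONEST FRAMING (run/shared/lean/pub/bsd-eis/): ONE conditional theorem; its six hypotheses are the registered stub texts of `Lines/crystal.lean` v10
VERBATIM — `hPub` = `stub_publishedFacts` (27 PUBLISHED named facts: b1's 17 MINUS the two Poitou–Tate dualities (tree theorems of bsd-schneider door-c4 g18 for every number
field, rebuilt into V11's 17-tuple below), the TEN of p668130'' MINUS Greenberg 2006 §5 A (tree theorem `sec5A_localH2_subsingleton_of_LOC1_holds`), CGLS Thm. 1.2.2's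
ω-partner and φ-half readings `thm122_fe_omegaPartner_charGrDual_torsion_muZero_lambda_eq` / `thm122_charGrDual_torsion_muZero_firstUnit_lambda_eq` (x2-p2 g12, p687863/p688467), Castella's member/Σ-frame congruence (x2-p2 g13, p695749)),
`hTwoVar` = `stub_twoVarRatDivPNew`, `hDescent` = `stub_acDescent` (line «accum»'s two stubs, ideator bsd-idea-12 g15), (I) = `CrystallineFibreOfCas20.crystallineFibre_of_cas20 hPub.2.….2` (the former `hFibre` / `stub_crystallineFibre`, now DERIVED),
`hMember` = `stub_memberInvariants` = KY24 Thm. 2.2.2 at weight `k` (μ ∧ λ, two NAMED statements; (i) ∧ (ii′) recovered by `memberInvariants_of_anacongWt`), `hWall` = `stub_wallAlgebraic` = [BR𝟙-anom] ∧ [BRω-split]-light (TWO character main conjectures STATED AND used at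
the ANOMALOUS local type only; [BR𝟙-anom] = binder `hbrA` of x2-p2 g12's p689389 token for token), `hMCB` = `stub_mazurMC_cellB` (crux 3); conclusion `…Theses.EisensteinPrimes.BSDpOnCellC` BY NAME. Nothing is asserted;
closing the crux = proving the six hypotheses by name. TERM: b1's V11 kernel statement (p623440) fed with road R-β from «accum» (`hDescent hTwoVar`),
Keller–Yin Lemma 5.1.1 DERIVED (`KellerYinLemma511OfBrAnom.lemma511_OPEN_of_prop125_of_brAnom_of_pub`: seven PUB + [BR𝟙-anom] + [BRω-split], orientation free via `SplitMultOrientationMirror`), both μ-slots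
(`CrystalTransports.muFrame_of_…` ⟸ (I) + (i), p688552), the NON-SPLIT count (x2-p2 g12 `CharGrSelmerCorankGeOfFacts.imprimitiveCount_nonsplit_of_an_of_brPrinted_of_pub''`:
ELEVEN PUB incl. the φ-half + [BRω-mult] DERIVED from the ω-partner fact via `BrOmegaMultOfPrint.brOmegaMult_light_of_print` (p688155) and the LEAD's
bridge `KellerYinBROmegaLightBridges.brOmegaMult_heavy_of_light` (p684333) + [AN-mult] DERIVED `CrystalTransports.han_of_…` ⟸ (I) + (II)
`CrystalLambdaSigma.lambda_sigmaEulerElement` (p687555) + (ii) ⟸ (ii′) `memberLambdaCount_of_free`), the SPLIT count (x2-p2 g11/g12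
`ImprimitiveCountSplitTransport.imprimitiveCount_split_of_hlatLight` (p684074) ∘ `SplitMultWallHlatLight.imprimitiveCount_split_hlatLight_of_brAnom_of_pub_tc`
(p689389) ∘ `ImprimitiveCountWallOfInputs.brOmegaSplit_medium_of_light` / `CrystalTransports.hanSplitLight_of_…` (p688601)), crux 3. CONDITIONAL-RESULT;
no summit statement, no BSD / MC / IMC is proved for any curve; 0 cells / labels / tiers move.

References: [KellerYin2024] Thm. 5.1.3 = Thm. D, Lemma 5.1.1, Lemma 5.1.2, Thm. 1.2.2 (arXiv:2402.12781v2) (shape only); [CastellaGrossiLeeSkinner2022]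
Prop. 1.2.5, Cor. 1.2.6, Thm. 1.2.2, Thm. 2.1.2, Thm. 2.2.1–2.2.2; [Castella2020JIMJ] Def. 1.3, Thm. 1.4 (i); [Kriz2016] Thm. 3, Prop. 37; [Hsieh2014] Thm. 1;
[CastellaGrossiSkinner2025] Thm. 3.3.1; cell: `Lines/crystal.lean` v10, `Lines/crystal.md` r10, `Lines/accum.md`; [Castella2020JIMJ] Thm. 2.11, [Castella2018] (3.1)/(4.1), [Skinner2016PacificMC] §2.6 (via p695749).
-/

set_option autoImplicit false
set_option linter.dupNamespace false

noncomputable section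


open scoped Classical MatrixGroups ModularForm

open CongruenceSubgroup WeierstrassCurve NumberField IsDedekindDomain Field PowerSeries
  Literature.NumberTheory.EllipticCurves Literature.NumberTheory.EllipticCurves.GreenbergSelmer
  Literature.NumberTheory.EllipticCurves.ModularForms Literature.NumberTheory.QuadraticFields
  Literature.NumberTheory.EllipticCurves.Rank1Residual
  Literature.NumberTheory.EllipticCurves.Rank1Residual.Typed
  Literature.NumberTheory.EllipticCurves.KrizLi2019
  Literature.NumberTheory.EllipticCurves.GreenbergVatsal2000
  Literature.NumberTheory.EllipticCurves.Wuthrich2014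
  Literature.NumberTheory.EllipticCurves.SteinWuthrich2013
  Literature.NumberTheory.EllipticCurves.Castella2018Exceptional
  Literature.NumberTheory.GaloisRepresentations Literature.NumberTheory.GaloisCohomology
  Literature.NumberTheory.Automorphic
  Summit.BirchSwinnertonDyer.Rank1Residual.X11b.AcSelmer
  Summit.BirchSwinnertonDyer.Rank1Residual.X11b.Halves
  Summit.BirchSwinnertonDyer.Rank1Residual.X11b
  Summit.BirchSwinnertonDyer.Rank1Residual Summit.BirchSwinnertonDyer.Rank1Residual.X1
  Summit.BirchSwinnertonDyer.Rank1Residual.X2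
open Literature.NumberTheory.EllipticCurves.KellerYin2024 (curveLocalLambda)



namespace Summit.BirchSwinnertonDyer.BirchSwinnertonDyer.Theorems.EisensteinPrimesBSDpOnCellCOfNamedFactsV10

open Literature.NumberTheory.EllipticCurves.CastellaGrossiLeeSkinner2022 Literature.NumberTheory.EllipticCurves.Castella2018
  Literature.NumberTheory.IwasawaTheory Literature.NumberTheory.IwasawaTheory.Greenberg2016
  Literature.NumberTheory.IwasawaTheory.Greenberg2006
  Summit.BirchSwinnertonDyer.Rank1Residual.X1.KellerYinMuLambdaSplit
open Literature.NumberTheory.EllipticCurves.KellerYin2024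
open Summit.BirchSwinnertonDyer.BirchSwinnertonDyer.Theorems.EisensteinPrimesBSDpOnCellCAccumDefs (TwoVarRatDivPNew)

/-- **Crux 4 `BSDpOnCellC` BY NAME from the six registered stub texts of line «crystal» v10** (see the module docstring for what each
hypothesis is and how the term is assembled). CONDITIONAL; nothing asserted. [claim: KellerYin2024, status: under-review]
[cite: KellerYin2024, Thm. 5.1.3 = Thm. D, Lemma 5.1.1, Thm. 1.2.2 (arXiv:2402.12781v2) (shape only)]
[cite: CastellaGrossiLeeSkinner2022, Prop. 1.2.5, Thm. 1.2.2, Thm. 2.1.2, Thm. 2.2.2] [cite: Castella2020JIMJ, Def. 1.3 and Thm. 1.4 (i)] [cite: Kriz2016, Thm. 3]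
[cite: Hsieh2014, Thm. 1] [cite: CastellaGrossiSkinner2025, Thm. 3.3.1] [cite: Castella2020JIMJ, Thm. 2.11] [cite: KellerYin2024, Thm. 2.2.2 (arXiv:2402.12781v2 p. 18) (shape only)] -/
theorem bsdpOnCellC_of_namedFactsV10
    (hPub :
    (((lambdaMu_multiplicative_of_gvPar ∧ thm16_charIdeal_dvd_multiplicative_of_reducible ∧
    thm61_splitMultiplicative ∧ thm61_nonsplitMultiplicative ∧
    (∀ (W : WeierstrassCurve ℚ) [W.IsElliptic] [W.IsGloballyMinimal] (p : ℕ) [Fact p.Prime],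
      greenberg_stevens (W := W) (p := p)) ∧
    exists_isNewformOf ∧
    hsieh2014_exists_anticyclotomicPAdicLFunction ∧
    (∀ (N : ℕ) [NeZero N] (W : WeierstrassCurve ℚ) (K : Type) [Field K] [NumberField K],
      gross_zagier N W K) ∧
    (∀ (N : ℕ) [NeZero N] (W : WeierstrassCurve ℚ) (K : Type) [Field K] [NumberField K],
      kolyvagin N W K) ∧
    rank_eq_analyticRank_of_analyticRank_le_one ∧ HoffsteinLuo1997_exists_twist_L_one_ne_zero ∧
    mazur_not_dvd_maninConstant_of_odd ∧ bsdRHS_eq_of_isIsogenous) ∧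
    thm210_thm211_bdpDisplay_pNew) ∧
    LiuZhangZhang2018.thm151_thm153_modularCurve_heegnerVector) ∧
    (prop125_characterGrSelmerDual_torsion_muZero_dim ∧ prop263_sur_of_crk ∧
      cor126_residualCharacter_globalLift ∧ cor126_residualCharacter_localSurjective ∧ prop411_selmer_isAlmostDivisible ∧
      prop41_globalEulerPoincareCorank ∧ prop42_localEulerPoincareCorank ∧ prop32_cohomology_isCofinitelyGenerated ∧
      thm212_exists_isKatzLFunction ∧
      CastellaGrossiLeeSkinner2022.thm122_fe_omegaPartner_charGrDual_torsion_muZero_lambda_eq ∧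
      CastellaGrossiLeeSkinner2022.thm122_charGrDual_torsion_muZero_firstUnit_lambda_eq ∧
      Literature.NumberTheory.EllipticCurves.Castella2018.cas20_thm211_memberForms_sigmaFrames_congr))
    (hTwoVar :
    ∀ (W : WeierstrassCurve ℚ) [W.IsElliptic] [W.IsGloballyMinimal] (p : ℕ) [Fact p.Prime],
      CellC W p → TwoVarRatDivPNew W p)
    (hDescent :
    (∀ (W : WeierstrassCurve ℚ) [W.IsElliptic] [W.IsGloballyMinimal] (p : ℕ) [Fact p.Prime],
      CellC W p → TwoVarRatDivPNew W p) →
    (∀ (W : WeierstrassCurve ℚ) [W.IsElliptic] [W.IsGloballyMinimal] (p : ℕ) [Fact p.Prime],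
      CellC W p → ¬ W.HasSplitMultiplicativeReductionAtPrime p → NonsplitKolyvaginDivOnTreeIntOther W p) ∧
    (∀ (W : WeierstrassCurve ℚ) [W.IsElliptic] [W.IsGloballyMinimal] (p : ℕ) [Fact p.Prime],
      CellC W p → W.HasSplitMultiplicativeReductionAtPrime p → SplitKolyvaginDivOnTreeIntOther W p))
    (hMember :
    Literature.NumberTheory.EllipticCurves.KellerYin2024.thm222_anacong_hidaMember_sigma_mu_OPEN ∧
      Literature.NumberTheory.EllipticCurves.KellerYin2024.thm222_anacong_hidaMember_sigma_lambda_OPEN)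
    (hWall :
    (∀ (p : ℕ) [Fact p.Prime],
      2 < p → ∀ (K : Type) [Field K] [NumberField K], IsImaginaryQuadratic K →
        SatisfiesHeegnerHypothesis p K → Odd (NumberField.discr K) → NumberField.discr K ≠ -3 →
      ∀ (ι : K →+* ℚ_[p]) (v vbar : HeightOneSpectrum (𝓞 K)),
        (∀ x : 𝓞 K, x ∈ v.asIdeal ↔ ‖ι (x : K)‖ < 1) →
        ((p : ℕ) : 𝓞 K) ∈ vbar.asIdeal → vbar ≠ v →
      ∀ (κ : ZpExtension K p), κ.IsAnticyclotomic →
      ∀ (γ : absoluteGaloisGroup K) [Fact (κ.IsTopGenerator γ)],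
      ∀ (ι' : PadicAlgCl p ≃+* ℂ),
        (∀ (w : InfinitePlace K) (k : 𝓞 K), k ∈ v.asIdeal ↔ ‖ι'.symm (w.embedding (k : K))‖ < 1) →
      ∀ (θ : FramedGaloisRep ℚ (padicCoeffIntegers (∅ : Set (PadicAlgCl p))) 1),
        (∀ σ : absoluteGaloisGroup ℚ, θ σ ^ (p - 1) = 1) →
      ∀ (C : ℕ), SatisfiesHeegnerHypothesis C K →
        (∀ u : HeightOneSpectrum (𝓞 ℚ), ((C : ℤ) : 𝓞 ℚ) ∉ u.asIdeal → θ.IsUnramifiedAt u) →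
        (∀ u : HeightOneSpectrum (𝓞 ℚ), ((p : ℕ) : 𝓞 ℚ) ∈ u.asIdeal → θ.IsUnramifiedAt u) →
        (∀ g ∈ decomp vbar, ∀ m : charModule (∅ : Set (PadicAlgCl p)) (θ.restrictField K), p • m = 0 → g • m = m) →
      ∀ (θK : HeckeCharacter K), IsHeckeCharOf ι' (θ.restrictField K) θK →
      ∀ (D : DatumDualData κ γ (charModule (∅ : Set (PadicAlgCl p)) (θ.restrictField K))
          (Castella2018.AcSelmer.bdpData (charModule (∅ : Set (PadicAlgCl p)) (θ.restrictField K)) p vbar)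
          (∅ : Set (HeightOneSpectrum (𝓞 K)))),
      ∀ (Cbar : Finset (HeightOneSpectrum (𝓞 K))), (∀ u ∈ Cbar, ¬ θK.IsUnramifiedAt u) →
      ∀ (ΩK : ℂ) (Ωp : (unrIntegers p)ˣ) (L : UnrSeries p), ΩK ≠ 0 →
        IsKatzLFunction ι' v vbar Cbar κ γ θK ΩK ((Ωp : unrIntegers p) : ℂ_[p]) L →
      Module.Finite (IwasawaAlgebra p) D.X ∧ Module.IsTorsion (IwasawaAlgebra p) D.X ∧
        muInvariant p D.X = 0 ∧
        ∃ m : ℕ, FirstUnitCoeffAt L m ∧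
          lambdaInvariant p D.X =
            m + (if ∀ σ : absoluteGaloisGroup K, θ.restrictField K σ = 1 then 1 else 0)) ∧
      (∀ (W : WeierstrassCurve ℚ) [W.IsElliptic] [W.IsGloballyMinimal] (p : ℕ) [Fact p.Prime],
      2 < p → Mult W p → W.HasSplitMultiplicativeReductionAtPrime p →
      ∀ (K : Type) [Field K] [NumberField K],
        IsImaginaryQuadratic K → SatisfiesHeegnerHypothesis (W.conductorNorm ℤ) K →
        Odd (NumberField.discr K) → NumberField.discr K ≠ -3 →
        ∀ (κ : ZpExtension K p), κ.IsAnticyclotomic →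
          ∀ (γ : Field.absoluteGaloisGroup K) [Fact (κ.IsTopGenerator γ)]
            (𝔭 : HeightOneSpectrum (𝓞 K)), ((p : ℕ) : 𝓞 K) ∈ 𝔭.asIdeal →
            𝔭.asIdeal.ramificationIdx (𝓞 ℚ) = 1 → 𝔭.asIdeal.inertiaDeg (𝓞 ℚ) = 1 →
            ∀ (𝔭bar : HeightOneSpectrum (𝓞 K)), ((p : ℕ) : 𝓞 K) ∈ 𝔭bar.asIdeal → 𝔭bar ≠ 𝔭 →
              ((Ideal.span {(p : ℤ)}).primesOver (𝓞 K)).ncard = 2 →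
            ∀ (ι' : PadicAlgCl p ≃+* ℂ),
              (∀ (w : InfinitePlace K) (k : 𝓞 K), k ∈ 𝔭.asIdeal ↔ ‖ι'.symm (w.embedding (k : K))‖ < 1) →
            ∀ (Φ : AddSubgroup (geomTorsion W (p : ℤ))), IsRationalLine W p Φ →
            ∀ (θsub θquot : FramedGaloisRep ℚ (padicCoeffIntegers (∅ : Set (PadicAlgCl p))) 1),
              IsTeichmullerLiftOn (∅ : Set (PadicAlgCl p)) (Φ.map (geomTorsion W (p : ℤ)).subtype) θsub →
              IsTeichmullerLiftOnQuot (∅ : Set (PadicAlgCl p)) (Φ.map (geomTorsion W (p : ℤ)).subtype)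
                (geomTorsion W (p : ℤ)) θquot →
            ∀ (φ ψ : FramedGaloisRep ℚ (padicCoeffIntegers (∅ : Set (PadicAlgCl p))) 1),
              (φ = θsub ∧ ψ = θquot ∨ φ = θquot ∧ ψ = θsub) →
              (∀ u : HeightOneSpectrum (𝓞 ℚ), ((p : ℕ) : 𝓞 ℚ) ∈ u.asIdeal → φ.IsUnramifiedAt u) →
            ∀ (θK : HeckeCharacter K), IsHeckeCharOf ι' (φ.restrictField K) θK →
            ∀ (Cbar : Finset (HeightOneSpectrum (𝓞 K))), (∀ u ∈ Cbar, ¬ θK.IsUnramifiedAt u) →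
            ∀ (ΩK' : ℂ) (Ωp' : (unrIntegers p)ˣ) (Lφ : UnrSeries p), ΩK' ≠ 0 →
              IsKatzLFunction ι' 𝔭 𝔭bar Cbar κ γ θK ΩK' ((Ωp' : unrIntegers p) : ℂ_[p]) Lφ →
            ∀ nφ : ℕ, FirstUnitCoeffAt Lφ nφ →
            ∀ (Dψ : DatumDualData κ γ (charModule (∅ : Set (PadicAlgCl p)) (ψ.restrictField K))
                (Castella2018.AcSelmer.bdpData (charModule (∅ : Set (PadicAlgCl p)) (ψ.restrictField K)) p 𝔭bar)
                (∅ : Set (HeightOneSpectrum (𝓞 K)))),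
              Module.Finite (IwasawaAlgebra p) Dψ.X ∧ Module.IsTorsion (IwasawaAlgebra p) Dψ.X ∧
                muInvariant p Dψ.X = 0 ∧ lambdaInvariant p Dψ.X = nφ))
    (hMCB :
    Summit.BirchSwinnertonDyer.BirchSwinnertonDyer.Theses.EisensteinPrimes.MazurMCOnCellB)
    : Summit.BirchSwinnertonDyer.BirchSwinnertonDyer.Theses.EisensteinPrimes.BSDpOnCellC := by
  -- b1's 17-tuple `hPub.1` of V11 REBUILT: its Poitou–Tate conjuncts are the tree theorems of bsd-schneider door-c4 g18 (every number field)
  obtain ⟨⟨⟨h1, h2, h3, h4, h5, h6, h9, h10, h11, h12, h13, h14, h15⟩, h16⟩, h17⟩ := hPub.1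
  -- v10: (i) ∧ (ii′) at the crystalline member, formerly the EXPLICIT text of `stub_memberInvariants`, RECOVERED token for token from the two
  -- weight-`k` named statements of Keller–Yin 2024 Thm. 2.2.2 (x2-p2 g13, p692600/p693188)
  have hMemberI := Summit.BirchSwinnertonDyer.BirchSwinnertonDyer.Theorems.MemberInvariantsOfAnacongWt.memberInvariants_of_anacongWt hMember.1 hMember.2
  -- v10: the crystalline fibre congruence (I), formerly `stub_crystallineFibre`, DERIVED from Castella's member/Σ-frame congruence (x2-p2 g13, p695749/p696082)
  have hFibre := Summit.BirchSwinnertonDyer.BirchSwinnertonDyer.Theorems.CrystallineFibreOfCas20.crystallineFibre_of_cas20 hPub.2.2.2.2.2.2.2.2.2.2.2.2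
  exact Summit.BirchSwinnertonDyer.BirchSwinnertonDyer.Theorems.BSDpOnCellCResidualV11.bsdpOnCellC_of_publishedFacts_of_divIntOther_of_lemma511_OPEN_of_muFrame_of_imprimitiveCount_of_cellB
    ⟨⟨⟨h1, h2, h3, h4, h5, h6, fun K _ _ ↦ Summit.BirchSwinnertonDyer.BirchSwinnertonDyer.Theorems.SchneiderFreeAdditiveX3.PoitouTateReduction.poitouTate_selmerStructure_duality_holds K,
        fun K _ _ ↦ Summit.BirchSwinnertonDyer.BirchSwinnertonDyer.Theorems.SchneiderFreeAdditiveX3.PoitouTateReduction.poitouTate_sha_tateDual_holds K, h9, h10, h11, h12, h13, h14, h15⟩, h16⟩, h17⟩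
    (hDescent hTwoVar).1 (hDescent hTwoVar).2
    (Summit.BirchSwinnertonDyer.BirchSwinnertonDyer.Theorems.KellerYinLemma511OfBrAnom.lemma511_OPEN_of_prop125_of_brAnom_of_pub
      hPub.2.1 hPub.2.2.1 hPub.2.2.2.2.2.2.1 hPub.2.2.2.2.2.2.2.1 Literature.NumberTheory.IwasawaTheory.Greenberg2006.sec5A_localH2_subsingleton_of_LOC1_holds
      hPub.2.2.2.2.2.2.2.2.1 hPub.2.2.2.2.2.2.2.2.2.1 hWall.1 hWall.2)
    (Summit.BirchSwinnertonDyer.BirchSwinnertonDyer.Theorems.CrystalTransports.muFrame_of_crystallineFibre_of_memberMuZero hFibre hMemberI.1).1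
    (Summit.BirchSwinnertonDyer.BirchSwinnertonDyer.Theorems.CrystalTransports.muFrame_of_crystallineFibre_of_memberMuZero hFibre hMemberI.1).2
    (Summit.BirchSwinnertonDyer.BirchSwinnertonDyer.Theorems.CharGrSelmerCorankGeOfFacts.imprimitiveCount_nonsplit_of_an_of_brPrinted_of_pub''
      hPub.2.1 hPub.2.2.1 Literature.NumberTheory.IwasawaTheory.Greenberg2006.sec5A_localH2_subsingleton_of_LOC1_holds hPub.2.2.2.1 hPub.2.2.2.2.1
      hPub.2.2.2.2.2.1 hPub.2.2.2.2.2.2.1 hPub.2.2.2.2.2.2.2.1 hPub.2.2.2.2.2.2.2.2.1 hPub.2.2.2.2.2.2.2.2.2.1 hPub.2.2.2.2.2.2.2.2.2.2.2.1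
      (Summit.BirchSwinnertonDyer.BirchSwinnertonDyer.Theorems.KellerYinBROmegaLightBridges.brOmegaMult_heavy_of_light
        (Summit.BirchSwinnertonDyer.BirchSwinnertonDyer.Theorems.BrOmegaMultOfPrint.brOmegaMult_light_of_print hPub.2.2.2.2.2.2.2.2.2.2.1))
      (Summit.BirchSwinnertonDyer.BirchSwinnertonDyer.Theorems.CrystalTransports.han_of_crystallineFibre_of_memberInvariants hFibre
        Summit.BirchSwinnertonDyer.BirchSwinnertonDyer.Theorems.CrystalLambdaSigma.lambda_sigmaEulerElement
        (Summit.BirchSwinnertonDyer.BirchSwinnertonDyer.Theorems.CrystalTransports.memberLambdaCount_of_free hMemberI.2)))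
    (Summit.BirchSwinnertonDyer.BirchSwinnertonDyer.Theorems.ImprimitiveCountSplitTransport.imprimitiveCount_split_of_hlatLight h6
      (Summit.BirchSwinnertonDyer.BirchSwinnertonDyer.Theorems.SplitMultWallHlatLight.imprimitiveCount_split_hlatLight_of_brAnom_of_pub_tc
        hPub.2.2.1 hPub.2.2.2.2.2.2.1 hPub.2.2.2.2.2.2.2.1 Literature.NumberTheory.IwasawaTheory.Greenberg2006.sec5A_localH2_subsingleton_of_LOC1_holds hPub.2.2.2.2.2.2.2.2.1 hPub.2.2.2.2.2.2.2.2.2.1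
        hWall.1 (Summit.BirchSwinnertonDyer.BirchSwinnertonDyer.Theorems.ImprimitiveCountWallOfInputs.brOmegaSplit_medium_of_light hWall.2)
        (Summit.BirchSwinnertonDyer.BirchSwinnertonDyer.Theorems.CrystalTransports.hanSplitLight_of_crystallineFibre_of_memberInvariants hFibre
          Summit.BirchSwinnertonDyer.BirchSwinnertonDyer.Theorems.CrystalLambdaSigma.lambda_sigmaEulerElement hMemberI.2)))
    hMCB

end Summit.BirchSwinnertonDyer.BirchSwinnertonDyer.Theorems.EisensteinPrimesBSDpOnCellCOfNamedFactsV10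

end
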